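import Literature.Computability.Cryptography.WordRAM
import HarnessLib

/-!
# The word RAM — value and address bounds for oracle-free runs

A word-RAM program run at word size `w` *without an oracle* only ever holds values, and only
ever writes to addresses, bounded by `V := max (2 ^ w - 1) (P.maxConst)` where `P.maxConst` is
the largest constant (immediate or address literal) occurring in the program:

* `Operand.const`, `Instr.maxConst`, `Program.maxConst`: the constants of a program;
* `MemLE V mem`: every cell of `mem` holds a value `≤ V`;
* `BinOp.eval_le`: the unit-cost operations do not create values above `max (2 ^ w - 1) 1`
  from operands `≤ V` (`+ − × or xor shl` are reduced modulo `2 ^ w`; `÷ mod and shr` are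
  bounded by their first operand; comparisons return `0`/`1`);
* `step_memLE`: one step under the trivial oracle `noOracle` preserves `MemLE V`;
  `step_mem_apply_of_lt`: it does not write above address `V`;
* `init_memLE`: the initial memory is bounded by `2 ^ w - 1`;
* `iterate_step_memLE`, `HaltsWithin.memLE`, `HaltsWithin.mem_apply_of_lt`: the bounds along
  a whole run.

Consequently an oracle-free program with `O(log L)`-bit words is a `poly(L)`-space device
whatever its time budget — the observation behind the correction of
`FGReducible.trulySubTime` in `Literature.Computability.Cryptography.FGComplexity` — and, in the
proof of VVW ICM 2018, Prop. 2.1, the constant `k'` of the simulating machine is read off from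
these bounds (every value of the simulated runs must fit in a `k' · width`-bit word).

## References

* T. Hagerup, *Sorting and searching on the word RAM*, STACS 1998, §2 (word-RAM conventions:
  values are `w`-bit words).
* V. Vassilevska Williams, *On some fine-grained questions in algorithms and complexity*,
  Proc. ICM 2018, §2.
-/

namespace Literature.Computability.Cryptography.WordRAM

open StateTransition

/-! ## Constants of a program -/

/-- The constant carried by an operand: the immediate value, or the address literal. [folklore] -/
def Operand.const : Operand → ℕ
  | .imm c => c
  | .dir a => a
  | .ind a => a

/-- The constant of an immediate operand. [folklore] -/
@[simp] theorem Operand.const_imm (c : ℕ) : (Operand.imm c).const = c := rfl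
/-- The constant of a direct operand is its address. [folklore] -/
@[simp] theorem Operand.const_dir (a : ℕ) : (Operand.dir a).const = a := rfl
/-- The constant of an indirect operand is its address. [folklore] -/
@[simp] theorem Operand.const_ind (a : ℕ) : (Operand.ind a).const = a := rfl

/-- The largest constant (immediate or address literal) of an instruction; jump targets are not
memory constants and are ignored. [folklore] -/
def Instr.maxConst : Instr → ℕ
  | .op _ dst x y => max dst.const (max x.const y.const)
  | .jmp _ => 0
  | .jz x _ => x.const
  | .rand dst => dst.const
  | .query qa ql aa => max qa.const (max ql.const aa.const)
  | .halt => 0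

/-- The largest constant (immediate or address literal) occurring in a program. [folklore] -/
def Program.maxConst (P : Program) : ℕ :=
  (P.map Instr.maxConst).foldr max 0

/-- Every instruction's constants are bounded by the program's `maxConst`. [folklore] -/
theorem Instr.maxConst_le_of_mem {P : Program} {I : Instr} (h : I ∈ P) :
    I.maxConst ≤ Program.maxConst P := by
  unfold Program.maxConst
  induction P with
  | nil => simp at h
  | cons J P ih =>
    rw [List.map_cons, List.foldr_cons]
    rcases List.mem_cons.1 h with rfl | h'
    · exact le_max_left _ _
    · exact le_trans (ih h') (le_max_right _ _)

/-- The constants of the instruction at position `i` are bounded by `maxConst`. [folklore] -/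
theorem Instr.maxConst_le_of_getElem? {P : Program} {i : ℕ} {I : Instr} (h : P[i]? = some I) :
    I.maxConst ≤ Program.maxConst P :=
  Instr.maxConst_le_of_mem (List.mem_of_getElem? h)

/-! ## Bounded memories -/

/-- `MemLE V mem`: every memory cell holds a value at most `V`. [folklore] -/
def MemLE (V : ℕ) (mem : ℕ → ℕ) : Prop :=
  ∀ a, mem a ≤ V

/-- Reading an operand whose constant is `≤ V` from a `V`-bounded memory gives a value `≤ V`. [folklore] -/
theorem Operand.read_le {V : ℕ} {mem : ℕ → ℕ} (hm : MemLE V mem) :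
    ∀ (o : Operand), o.const ≤ V → o.read mem ≤ V
  | .imm _, ho => ho
  | .dir a, _ => hm a
  | .ind a, _ => hm (mem a)

/-- Writing a value `≤ V` keeps the memory `V`-bounded. [folklore] -/
theorem Operand.write_memLE {V : ℕ} {mem : ℕ → ℕ} {v : ℕ} (hm : MemLE V mem) (hv : v ≤ V) :
    ∀ o : Operand, MemLE V (o.write mem v)
  | .imm _ => hm
  | .dir a => fun b => by
      show Function.update mem a v b ≤ V
      rcases eq_or_ne b a with rfl | h
      · rw [Function.update_self]; exact hv
      · rw [Function.update_of_ne h]; exact hm b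
  | .ind a => fun b => by
      show Function.update mem (mem a) v b ≤ V
      rcases eq_or_ne b (mem a) with rfl | h
      · rw [Function.update_self]; exact hv
      · rw [Function.update_of_ne h]; exact hm b

/-- Writing through an operand whose constant is `≤ V`, in a `V`-bounded memory, does not touch
addresses above `V`. [folklore] -/
theorem Operand.write_apply_of_lt {V : ℕ} {mem : ℕ → ℕ} {v : ℕ} (hm : MemLE V mem) :
    ∀ (o : Operand), o.const ≤ V → ∀ {b : ℕ}, V < b → o.write mem v b = mem b
  | .imm _, _, _, _ => rfl
  | .dir a, ho, b, hb => by
      show Function.update mem a v b = mem b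
      rw [Function.update_of_ne]
      exact Nat.ne_of_gt (lt_of_le_of_lt ho hb)
  | .ind a, _, b, hb => by
      show Function.update mem (mem a) v b = mem b
      rw [Function.update_of_ne]
      exact Nat.ne_of_gt (lt_of_le_of_lt (hm a) hb)

/-- A value reduced modulo `2 ^ w` is at most `2 ^ w - 1`. [folklore] -/
theorem mod_two_pow_le (x w : ℕ) : x % 2 ^ w ≤ 2 ^ w - 1 :=
  Nat.le_sub_one_of_lt (Nat.mod_lt _ (Nat.pow_pos Nat.two_pos))

/-- The unit-cost operations do not create large values: from a first operand `≤ V` (and any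
second operand) the result is `≤ V` as soon as `2 ^ w - 1 ≤ V` and `1 ≤ V`. [folklore] -/
theorem BinOp.eval_le {w V x y : ℕ} (hx : x ≤ V) (hw : 2 ^ w - 1 ≤ V) (h1 : 1 ≤ V) :
    ∀ o : BinOp, o.eval w x y ≤ V
  | .add => le_trans (mod_two_pow_le _ _) hw
  | .sub => le_trans (mod_two_pow_le _ _) hw
  | .mul => le_trans (mod_two_pow_le _ _) hw
  | .div => le_trans (Nat.div_le_self x y) hx
  | .mod => le_trans (Nat.mod_le x y) hx
  | .band => le_trans Nat.and_le_left hx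
  | .bor => le_trans (mod_two_pow_le _ _) hw
  | .bxor => le_trans (mod_two_pow_le _ _) hw
  | .shl => le_trans (mod_two_pow_le _ _) hw
  | .shr => le_trans (Nat.shiftRight_le x y) hx
  | .lt => by show (if x < y then 1 else 0) ≤ V; split_ifs <;> omega
  | .eq => by show (if x = y then 1 else 0) ≤ V; split_ifs <;> omega

/-- `writeSeg` of values `≤ V` into a `V`-bounded memory is `V`-bounded. [folklore] -/
theorem writeSeg_memLE {V : ℕ} :
    ∀ (l : List ℕ) (mem : ℕ → ℕ) (a : ℕ), MemLE V mem → (∀ v ∈ l, v ≤ V) →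
      MemLE V (writeSeg mem a l)
  | [], mem, a, hm, _ => hm
  | v :: l, mem, a, hm, hl => by
      rw [writeSeg_cons]
      refine writeSeg_memLE l _ _ (fun b => ?_) (fun u hu => hl u (List.mem_cons_of_mem _ hu))
      rcases eq_or_ne b a with rfl | h
      · rw [Function.update_self]; exact hl v List.mem_cons_self
      · rw [Function.update_of_ne h]; exact hm b

/-! ## One step -/

/-- **Values stay bounded.** One step of `P` at word size `w` under the trivial oracle preserves
`MemLE V` for any `V ≥ max (2 ^ w - 1) (max P.maxConst 1)`. (With a genuine oracle the answer
*length* written by `query` is not reduced modulo `2 ^ w`, and no such bound holds.) [folklore] -/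
theorem step_memLE {P : Program} {w : ℕ} {ρ : ℕ → ℕ} {c c' : Cfg} {V : ℕ}
    (hw : 2 ^ w - 1 ≤ V) (h1 : 1 ≤ V) (hP : Program.maxConst P ≤ V) (hc : MemLE V c.mem)
    (hs : step P w noOracle ρ c = some c') : MemLE V c'.mem := by
  unfold step at hs
  cases hpc : c.pc with
  | none => simp [hpc] at hs
  | some i =>
    simp only [hpc] at hs
    cases hI : P[i]? with
    | none => simp only [hI, Option.some.injEq] at hs; subst hs; exact hc
    | some I =>
      have hIc : I.maxConst ≤ V := le_trans (Instr.maxConst_le_of_getElem? hI) hP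
      simp only [hI] at hs
      cases I with
      | halt => simp only [Option.some.injEq] at hs; subst hs; exact hc
      | jmp t => simp only [Option.some.injEq] at hs; subst hs; exact hc
      | jz x t => simp only [Option.some.injEq] at hs; subst hs; exact hc
      | op o dst x y =>
        simp only [Option.some.injEq] at hs; subst hs
        simp only [Instr.maxConst, max_le_iff] at hIc
        exact Operand.write_memLE hc
          (BinOp.eval_le (Operand.read_le hc x hIc.2.1) hw h1 o) dst
      | rand dst =>
        simp only [Option.some.injEq] at hs; subst hs
        exact Operand.write_memLE hc (le_trans (mod_two_pow_le _ _) hw) dst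
      | query qa ql aa =>
        simp only [noOracle_apply, List.map_nil, List.length_nil, Option.some.injEq] at hs
        subst hs
        simp only [writeSeg_nil]
        intro b
        rcases eq_or_ne b (aa.read c.mem) with rfl | h
        · rw [Function.update_self]; exact Nat.zero_le _
        · rw [Function.update_of_ne h]; exact hc b

/-- **High addresses are never written.** One step of `P` at word size `w` under the trivial
oracle does not change any cell above `V ≥ max (2 ^ w - 1) (max P.maxConst 1)` of a `V`-bounded
memory. [folklore] -/
theorem step_mem_apply_of_lt {P : Program} {w : ℕ} {ρ : ℕ → ℕ} {c c' : Cfg} {V : ℕ}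
    (hP : Program.maxConst P ≤ V) (hc : MemLE V c.mem)
    (hs : step P w noOracle ρ c = some c') {b : ℕ} (hb : V < b) : c'.mem b = c.mem b := by
  unfold step at hs
  cases hpc : c.pc with
  | none => simp [hpc] at hs
  | some i =>
    simp only [hpc] at hs
    cases hI : P[i]? with
    | none => simp only [hI, Option.some.injEq] at hs; subst hs; rfl
    | some I =>
      have hIc : I.maxConst ≤ V := le_trans (Instr.maxConst_le_of_getElem? hI) hP
      simp only [hI] at hs
      cases I with
      | halt => simp only [Option.some.injEq] at hs; subst hs; rfl
      | jmp t => simp only [Option.some.injEq] at hs; subst hs; rfl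
      | jz x t => simp only [Option.some.injEq] at hs; subst hs; rfl
      | op o dst x y =>
        simp only [Option.some.injEq] at hs; subst hs
        simp only [Instr.maxConst, max_le_iff] at hIc
        exact Operand.write_apply_of_lt hc dst hIc.1 hb
      | rand dst =>
        simp only [Option.some.injEq] at hs; subst hs
        simp only [Instr.maxConst] at hIc
        exact Operand.write_apply_of_lt hc dst hIc hb
      | query qa ql aa =>
        simp only [noOracle_apply, List.map_nil, List.length_nil, Option.some.injEq] at hs
        subst hs
        simp only [writeSeg_nil]
        simp only [Instr.maxConst, max_le_iff] at hIc
        rw [Function.update_of_ne]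
        exact Nat.ne_of_gt (lt_of_le_of_lt (Operand.read_le hc aa hIc.2.2) hb)

/-- The program counter, coin position and query log are irrelevant to `MemLE`; the initial
memory on any input is bounded by `2 ^ w - 1` (every stored word is reduced modulo `2 ^ w`, all
other cells are `0`). [folklore] -/
theorem init_memLE (w : ℕ) (x : List ℕ) {V : ℕ} (hw : 2 ^ w - 1 ≤ V) : MemLE V (init w x).mem := by
  unfold init
  refine writeSeg_memLE _ _ _ (fun b => ?_) (fun v hv => ?_)
  · rcases eq_or_ne b 0 with rfl | h
    · rw [Function.update_self]; exact le_trans (mod_two_pow_le _ _) hw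
    · rw [Function.update_of_ne h]; exact Nat.zero_le _
  · obtain ⟨u, -, rfl⟩ := List.mem_map.1 hv
    exact le_trans (mod_two_pow_le _ _) hw

/-! ## Whole runs -/

/-- Along any number of steps under the trivial oracle, memory stays `V`-bounded. [folklore] -/
theorem iterate_step_memLE {P : Program} {w : ℕ} {ρ : ℕ → ℕ} {V : ℕ}
    (hw : 2 ^ w - 1 ≤ V) (h1 : 1 ≤ V) (hP : Program.maxConst P ≤ V) :
    ∀ (n : ℕ) {c c' : Cfg}, MemLE V c.mem →
      (flip bind (step P w noOracle ρ))^[n] (some c) = some c' → MemLE V c'.mem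
  | 0, c, c', hc, h => by
      simp only [Function.iterate_zero, id_eq, Option.some.injEq] at h
      subst h; exact hc
  | n + 1, c, c', hc, h => by
      rw [Function.iterate_succ_apply] at h
      change (flip bind (step P w noOracle ρ))^[n] (step P w noOracle ρ c) = some c' at h
      cases hs : step P w noOracle ρ c with
      | none =>
        rw [hs] at h
        have : (flip bind (step P w noOracle ρ))^[n] (none : Option Cfg) = none :=
          Function.iterate_fixed rfl n
        rw [this] at h
        exact absurd h (by simp)
      | some d =>
        rw [hs] at h
        exact iterate_step_memLE hw h1 hP n (step_memLE hw h1 hP hc hs) h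

/-- Along any number of steps under the trivial oracle, cells above `V` keep their contents. [folklore] -/
theorem iterate_step_mem_apply_of_lt {P : Program} {w : ℕ} {ρ : ℕ → ℕ} {V : ℕ}
    (hw : 2 ^ w - 1 ≤ V) (h1 : 1 ≤ V) (hP : Program.maxConst P ≤ V) :
    ∀ (n : ℕ) {c c' : Cfg}, MemLE V c.mem →
      (flip bind (step P w noOracle ρ))^[n] (some c) = some c' → ∀ {b : ℕ}, V < b →
        c'.mem b = c.mem b
  | 0, c, c', _, h, b, _ => by
      simp only [Function.iterate_zero, id_eq, Option.some.injEq] at h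
      subst h; rfl
  | n + 1, c, c', hc, h, b, hb => by
      rw [Function.iterate_succ_apply] at h
      change (flip bind (step P w noOracle ρ))^[n] (step P w noOracle ρ c) = some c' at h
      cases hs : step P w noOracle ρ c with
      | none =>
        rw [hs] at h
        have : (flip bind (step P w noOracle ρ))^[n] (none : Option Cfg) = none :=
          Function.iterate_fixed rfl n
        rw [this] at h
        exact absurd h (by simp)
      | some d =>
        rw [hs] at h
        rw [iterate_step_mem_apply_of_lt hw h1 hP n (step_memLE hw h1 hP hc hs) h hb]
        exact step_mem_apply_of_lt hP hc hs hb

/-- The canonical bound of an oracle-free run at word size `w`: `max (2 ^ w - 1) (max K 1)` with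
`K` the largest constant of the program. [folklore] -/
def valueBound (P : Program) (w : ℕ) : ℕ :=
  max (2 ^ w - 1) (max (Program.maxConst P) 1)

/-- The word capacity is below the value bound. [folklore] -/
theorem two_pow_sub_one_le_valueBound (P : Program) (w : ℕ) : 2 ^ w - 1 ≤ valueBound P w :=
  le_max_left _ _

/-- The program's constants are below the value bound. [folklore] -/
theorem maxConst_le_valueBound (P : Program) (w : ℕ) : Program.maxConst P ≤ valueBound P w :=
  le_trans (le_max_left _ _) (le_max_right _ _)

/-- The value bound is positive. [folklore] -/
theorem one_le_valueBound (P : Program) (w : ℕ) : 1 ≤ valueBound P w :=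
  le_trans (le_max_right _ _) (le_max_right _ _)

/-- `valueBound P w < 2 ^ w + P.maxConst + 1`: the bound is linear in the word capacity and the
program's constants. [folklore] -/
theorem valueBound_le (P : Program) (w : ℕ) : valueBound P w ≤ 2 ^ w + Program.maxConst P := by
  unfold valueBound
  have : 1 ≤ 2 ^ w := Nat.one_le_two_pow
  omega

/-- **Oracle-free runs are value-bounded.** In the halting configuration of a run under the
trivial oracle, every cell holds a value `≤ valueBound P w`. [folklore] -/
theorem HaltsWithin.memLE {P : Program} {w : ℕ} {ρ : ℕ → ℕ} {x : List ℕ} {t : ℕ} {c : Cfg}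
    (h : HaltsWithin P w noOracle ρ x t c) : MemLE (valueBound P w) c.mem := by
  obtain ⟨⟨e⟩, -⟩ := h
  exact iterate_step_memLE (two_pow_sub_one_le_valueBound P w) (one_le_valueBound P w)
    (maxConst_le_valueBound P w) e.steps (init_memLE w x (two_pow_sub_one_le_valueBound P w))
    e.evals_in_steps

/-- **Oracle-free runs are address-bounded.** In the halting configuration of a run under the
trivial oracle, every cell above `valueBound P w` still holds its initial content. [folklore] -/
theorem HaltsWithin.mem_apply_of_lt {P : Program} {w : ℕ} {ρ : ℕ → ℕ} {x : List ℕ} {t : ℕ}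
    {c : Cfg} (h : HaltsWithin P w noOracle ρ x t c) {b : ℕ} (hb : valueBound P w < b) :
    c.mem b = (init w x).mem b := by
  obtain ⟨⟨e⟩, -⟩ := h
  exact iterate_step_mem_apply_of_lt (two_pow_sub_one_le_valueBound P w) (one_le_valueBound P w)
    (maxConst_le_valueBound P w) e.steps (init_memLE w x (two_pow_sub_one_le_valueBound P w))
    e.evals_in_steps hb

/-- Every intermediate configuration of an oracle-free run (not only the halting one) is
value-bounded. [folklore] -/
theorem memLE_of_iterate_init {P : Program} {w : ℕ} {ρ : ℕ → ℕ} {x : List ℕ} {n : ℕ} {c : Cfg}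
    (h : (flip bind (step P w noOracle ρ))^[n] (some (init w x)) = some c) :
    MemLE (valueBound P w) c.mem :=
  iterate_step_memLE (two_pow_sub_one_le_valueBound P w) (one_le_valueBound P w)
    (maxConst_le_valueBound P w) n (init_memLE w x (two_pow_sub_one_le_valueBound P w)) h

/-- The output of an oracle-free run has entries `≤ valueBound P w` and length
`≤ valueBound P w`. [folklore] -/
theorem OutputsWithin.forall_le_valueBound {P : Program} {w : ℕ} {ρ : ℕ → ℕ} {x out : List ℕ}
    {t : ℕ} (h : OutputsWithin P w noOracle ρ x out t) :
    out.length ≤ valueBound P w ∧ ∀ v ∈ out, v ≤ valueBound P w := by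
  rw [outputsWithin_iff_exists_haltsWithin] at h
  obtain ⟨c, hc, rfl⟩ := h
  have hm := hc.memLE
  refine ⟨by simpa using hm 0, fun v hv => ?_⟩
  simp only [readOut, readSeg, List.mem_map, List.mem_range] at hv
  obtain ⟨i, -, rfl⟩ := hv
  exact hm _

end Literature.Computability.Cryptography.WordRAM
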